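import Mathlib
import Summits.Ventures.PercRepro2.Defs
import Summits.Ventures.PercRepro2.Independence
import Summits.Ventures.PercRepro2.Harris
import Summits.Ventures.PercRepro2.Graph
import Summits.Ventures.PercRepro2.Events
import Summits.Ventures.PercRepro2.Induced
import Summits.Ventures.PercRepro2.BHKAvoid
import Summits.Ventures.PercRepro2.ZCPendantFirstOrder
import Summits.Ventures.PercRepro2.ZCPendantSecondOrder

/-!
# Row 2′ZC is a theorem: two Harris covariances and one set-avoidance BHK slack
(blind cell PercRepro2, mine-a g30; MINE-A.md §85)

Percolation on any finite graph, any weight vector `p`, root `a₁`, marks `a₃, o`, and a cluster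
up-set `U = {C(a₁) ∈ 𝓔}` (`𝓔` an up-set of vertex sets).  With `e = {a₁ ↔ a₃}`, `L = {a₁ ↔ o}`,
`γ = {a₃ ↔ o}`, `D = eᶜ ∩ Lᶜ ∩ γᶜ`, `B = eᶜ ∩ Lᶜ ∩ γ`, the (ZC) expression of row 2′ZC is

  `Z = P(D)·(P(U ∩ eL) − P(U)P(eL)) − P(B)·(P(U ∩ e Lᶜ) − P(U)P(e Lᶜ))`

and the EXACT IDENTITY (`zc_main_identity`)

  `Z = P(D)·Cov(U, γ) + P(B)·Cov(U, L ∪ γ) + [ P(U ∩ eᶜ ∩ Lᶜ)·P(B) − P(U ∩ B)·P(eᶜ ∩ Lᶜ) ]`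

holds, where the two covariances are Harris (`U`, `γ`, `L ∪ γ` increasing) and the bracket is the
van den Berg–Häggström–Kahn cross-cluster inequality with SET avoidance (`bhk_cross_cluster_avoid`,
`s = a₁`, `X = {a₃, o}`, `t = a₃`, `𝓥 = {W ∣ o ∈ W}`): given that the root's cluster avoids both
marks, the up-set event of `C(a₁)` and `{o ∈ C(a₃)}` are negatively correlated.  Hence `Z ≥ 0`
(`zc_main`).  The certificate was found by an exact LP over the Harris/BHK dictionary on the five
types `{eL, eLᶜ, eᶜL, eᶜLᶜγᶜ, eᶜLᶜγ}` of the root's configuration (mine-a g30, codes/c2cert.py,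
target `Z`): multipliers `P(D)`, `P(B)`, `1`.  The identity is a polynomial identity modulo the
partition of unity of the five types.  No definition; one seat.
-/

namespace Summit.Ventures.PercRepro2

namespace ZCMain

section Algebra

variable {R : Type*} [CommRing R]

/-- The algebraic heart: with `g + X + Y + D + B = 1` (the five types), the (ZC) expression equals
the certificate combination.  Variables: `a = P(U eL)`, `c = P(U eLᶜ)`, `d = P(U eᶜL)`,
`e₀ = P(U eᶜLᶜγᶜ)`, `e₁ = P(U eᶜLᶜγ)`, `g = P(eL)`, `X = P(eLᶜ)`, `Y = P(eᶜL)`, `D = P(eᶜLᶜγᶜ)`,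
`B = P(eᶜLᶜγ)`. -/
lemma zc_identity (a c d e₀ e₁ g X Y D B : R) (hσ : g + X + Y + D + B = 1) :
    D * (a - (a + c + d + e₀ + e₁) * g) - B * (c - (a + c + d + e₀ + e₁) * X) =
      D * (a + e₁ - (a + c + d + e₀ + e₁) * (g + B)) +
        B * (a + d + e₁ - (a + c + d + e₀ + e₁) * (g + Y + B)) +
        ((e₀ + e₁) * B - e₁ * (D + B)) := by
  linear_combination (B * (a + c + d + e₀ + e₁)) * hσ

end Algebra

section Sets

variable {V : Type*} {E : Type*} (ends : E → Sym2 V) (a₁ a₃ o : V)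

/-- `{a₁ ↮ X}` for `X = {a₃, o}` is `eᶜ ∩ Lᶜ`. -/
lemma avoidAll_pair_eq [DecidableEq V] :
    avoidAll ends a₁ {a₃, o} = (connEvent ends a₁ a₃)ᶜ ∩ (connEvent ends a₁ o)ᶜ := by
  ext ω
  simp only [mem_avoidAll, Finset.mem_insert, Finset.mem_singleton, Set.mem_inter_iff,
    Set.mem_compl_iff, mem_connEvent]
  constructor
  · intro h
    exact ⟨h a₃ (Or.inl rfl), h o (Or.inr rfl)⟩
  · rintro ⟨h1, h2⟩ x hx
    rcases hx with rfl | rfl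
    · exact h1
    · exact h2

/-- `{a₁ ↔ o} ∪ {a₃ ↔ o}` is an up-set. -/
lemma isUpperSet_L_union_γ : IsUpperSet (connEvent ends a₁ o ∪ connEvent ends a₃ o) :=
  (isUpperSet_connEvent ends a₁ o).union (isUpperSet_connEvent ends a₃ o)

end Sets

section Main

variable {V : Type*} {E : Type*} [Fintype E] [DecidableEq E] [Fintype V] [DecidableEq V]
  {R : Type*} [Field R] [LinearOrder R] [IsStrictOrderedRing R]

omit [Fintype V] [DecidableEq V] [LinearOrder R] [IsStrictOrderedRing R] in
/-- **The identity of row 2′ZC**: the (ZC) expression is two covariances weighted by `P(D)`, `P(B)`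
plus the cross-cluster slack. -/
theorem zc_main_identity (p : E → R) (ends : E → Sym2 V) (a₁ a₃ o : V) (𝓔 : Set (Set V)) :
    let e := connEvent ends a₁ a₃
    let L := connEvent ends a₁ o
    let γ := connEvent ends a₃ o
    let U := clusterInEvent ends a₁ 𝓔
    prob p (eᶜ ∩ Lᶜ ∩ γᶜ) * (prob p (U ∩ (e ∩ L)) - prob p U * prob p (e ∩ L)) -
        prob p (eᶜ ∩ Lᶜ ∩ γ) * (prob p (U ∩ (e ∩ Lᶜ)) - prob p U * prob p (e ∩ Lᶜ)) =
      prob p (eᶜ ∩ Lᶜ ∩ γᶜ) * (prob p (U ∩ γ) - prob p U * prob p γ) +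
        prob p (eᶜ ∩ Lᶜ ∩ γ) * (prob p (U ∩ (L ∪ γ)) - prob p U * prob p (L ∪ γ)) +
        (prob p (U ∩ (eᶜ ∩ Lᶜ)) * prob p (eᶜ ∩ Lᶜ ∩ γ) -
          prob p (U ∩ γ ∩ (eᶜ ∩ Lᶜ)) * prob p (eᶜ ∩ Lᶜ)) := by
  intro e L γ U
  -- set identities (transitivity of connections)
  have s1 : γ ∩ e = e ∩ L := by
    rw [Set.inter_comm, ZCPendant.connEvent_inter_eq_inter_connEvent]
  have s2 : γ ∩ eᶜ = eᶜ ∩ Lᶜ ∩ γ := by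
    rw [Set.inter_comm, ZCPendant.compl_inter_connEvent_eq]
  have s3 : L ∩ γ = e ∩ L := ZCPendant.connEvent_o_inter_eq ends a₁ a₃ o
  have s6 : U ∩ γ ∩ e = U ∩ (e ∩ L) := by rw [Set.inter_assoc, s1]
  have s7 : U ∩ γ ∩ eᶜ = U ∩ γ ∩ (eᶜ ∩ Lᶜ) := by
    rw [Set.inter_assoc, s2, Set.inter_comm (eᶜ ∩ Lᶜ) γ, ← Set.inter_assoc]
  have s9 : U ∩ L ∩ e = U ∩ (e ∩ L) := by rw [Set.inter_assoc, Set.inter_comm L e]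
  have s10 : U ∩ L ∩ eᶜ = U ∩ eᶜ ∩ L := by
    rw [Set.inter_assoc, Set.inter_comm L eᶜ, ← Set.inter_assoc]
  have s11 : U ∩ eᶜ ∩ L = U ∩ (eᶜ ∩ L) := Set.inter_assoc _ _ _
  have s12 : U ∩ eᶜ ∩ Lᶜ = U ∩ (eᶜ ∩ Lᶜ) := Set.inter_assoc _ _ _
  -- the ten masses
  have hq : prob p γ = prob p (e ∩ L) + prob p (eᶜ ∩ Lᶜ ∩ γ) := by
    have := prob_inter_add_prob_inter_compl p γ e
    rw [s1, s2] at this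
    linear_combination -this
  have he : prob p e = prob p (e ∩ L) + prob p (e ∩ Lᶜ) :=
    (prob_inter_add_prob_inter_compl p e L).symm
  have hec : prob p eᶜ = prob p (eᶜ ∩ L) + prob p (eᶜ ∩ Lᶜ) :=
    (prob_inter_add_prob_inter_compl p eᶜ L).symm
  have hecLc : prob p (eᶜ ∩ Lᶜ) = prob p (eᶜ ∩ Lᶜ ∩ γ) + prob p (eᶜ ∩ Lᶜ ∩ γᶜ) :=
    (prob_inter_add_prob_inter_compl p (eᶜ ∩ Lᶜ) γ).symm
  have hcompl : prob p eᶜ = 1 - prob p e := prob_compl p e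
  have hL : prob p L = prob p (e ∩ L) + prob p (eᶜ ∩ L) := by
    have := prob_inter_add_prob_inter_compl p L e
    rw [Set.inter_comm L e, Set.inter_comm L eᶜ] at this
    exact this.symm
  have hLuγ : prob p (L ∪ γ) = prob p (e ∩ L) + prob p (eᶜ ∩ L) + prob p (eᶜ ∩ Lᶜ ∩ γ) := by
    have := prob_union_add_prob_inter p L γ
    rw [s3] at this
    linear_combination this + hL + hq
  -- the `U`-masses
  have hU : prob p U = prob p (U ∩ e) + prob p (U ∩ eᶜ) :=
    (prob_inter_add_prob_inter_compl p U e).symm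
  have hUe : prob p (U ∩ e) = prob p (U ∩ (e ∩ L)) + prob p (U ∩ (e ∩ Lᶜ)) := by
    have := prob_inter_add_prob_inter_compl p (U ∩ e) L
    rw [Set.inter_assoc, Set.inter_assoc] at this
    exact this.symm
  have hUec : prob p (U ∩ eᶜ) = prob p (U ∩ (eᶜ ∩ L)) + prob p (U ∩ (eᶜ ∩ Lᶜ)) := by
    have := prob_inter_add_prob_inter_compl p (U ∩ eᶜ) L
    rw [s11, s12] at this
    exact this.symm
  have hUecLc : prob p (U ∩ (eᶜ ∩ Lᶜ)) =
      prob p (U ∩ γ ∩ (eᶜ ∩ Lᶜ)) + prob p (U ∩ (eᶜ ∩ Lᶜ) ∩ γᶜ) := by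
    have := prob_inter_add_prob_inter_compl p (U ∩ (eᶜ ∩ Lᶜ)) γ
    rw [show U ∩ (eᶜ ∩ Lᶜ) ∩ γ = U ∩ γ ∩ (eᶜ ∩ Lᶜ) by
      rw [Set.inter_assoc, Set.inter_comm (eᶜ ∩ Lᶜ) γ, ← Set.inter_assoc]] at this
    exact this.symm
  have hUγ : prob p (U ∩ γ) = prob p (U ∩ (e ∩ L)) + prob p (U ∩ γ ∩ (eᶜ ∩ Lᶜ)) := by
    have := prob_inter_add_prob_inter_compl p (U ∩ γ) e
    rw [s6, s7] at this
    exact this.symm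
  have hUL : prob p (U ∩ L) = prob p (U ∩ (e ∩ L)) + prob p (U ∩ (eᶜ ∩ L)) := by
    have := prob_inter_add_prob_inter_compl p (U ∩ L) e
    rw [s9, s10, s11] at this
    exact this.symm
  have hULuγ : prob p (U ∩ (L ∪ γ)) =
      prob p (U ∩ (e ∩ L)) + prob p (U ∩ (eᶜ ∩ L)) + prob p (U ∩ γ ∩ (eᶜ ∩ Lᶜ)) := by
    have := prob_union_add_prob_inter p (U ∩ L) (U ∩ γ)
    rw [← Set.inter_union_distrib_left, show U ∩ L ∩ (U ∩ γ) = U ∩ (e ∩ L) by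
      rw [Set.inter_inter_inter_comm, Set.inter_self, s3]] at this
    linear_combination this + hUL + hUγ
  -- partition of unity
  have hσ : prob p (e ∩ L) + prob p (e ∩ Lᶜ) + prob p (eᶜ ∩ L) + prob p (eᶜ ∩ Lᶜ ∩ γᶜ) +
      prob p (eᶜ ∩ Lᶜ ∩ γ) = 1 := by
    linear_combination -he - hec - hecLc + hcompl
  have key := zc_identity (R := R) (prob p (U ∩ (e ∩ L))) (prob p (U ∩ (e ∩ Lᶜ)))
    (prob p (U ∩ (eᶜ ∩ L))) (prob p (U ∩ (eᶜ ∩ Lᶜ) ∩ γᶜ)) (prob p (U ∩ γ ∩ (eᶜ ∩ Lᶜ)))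
    (prob p (e ∩ L)) (prob p (e ∩ Lᶜ)) (prob p (eᶜ ∩ L)) (prob p (eᶜ ∩ Lᶜ ∩ γᶜ))
    (prob p (eᶜ ∩ Lᶜ ∩ γ)) hσ
  have hecLc' : prob p (eᶜ ∩ Lᶜ) = prob p (eᶜ ∩ Lᶜ ∩ γᶜ) + prob p (eᶜ ∩ Lᶜ ∩ γ) := by
    linear_combination hecLc
  rw [hq, hLuγ, hU, hUe, hUec, hUecLc, hUγ, hULuγ, hecLc']
  linear_combination key

/-- **ROW 2′ZC, IN FULL GENERALITY.**  For percolation on any finite graph with any weight vector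
`p`, root `a₁`, marks `a₃, o` and any cluster up-set `U = {C(a₁) ∈ 𝓔}`:
`P(D)·Cov(U, e ∩ L) ≥ P(B)·Cov(U, e ∩ Lᶜ)`, `D = {a₁ ↮ a₃, a₁ ↮ o, a₃ ↮ o}`,
`B = {a₁ ↮ a₃, a₁ ↮ o, a₃ ↔ o}`.  Proof: `zc_main_identity`, Harris for `(U, γ)` and
`(U, L ∪ γ)`, and `bhk_cross_cluster_avoid` for the root's cluster avoiding `{a₃, o}`. -/
theorem zc_main (p : E → R) (hp : IsProbVec p) (ends : E → Sym2 V) (a₁ a₃ o : V)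
    {𝓔 : Set (Set V)} (h𝓔 : IsUpperSet 𝓔) :
    let e := connEvent ends a₁ a₃
    let L := connEvent ends a₁ o
    let γ := connEvent ends a₃ o
    let U := clusterInEvent ends a₁ 𝓔
    0 ≤ prob p (eᶜ ∩ Lᶜ ∩ γᶜ) * (prob p (U ∩ (e ∩ L)) - prob p U * prob p (e ∩ L)) -
        prob p (eᶜ ∩ Lᶜ ∩ γ) * (prob p (U ∩ (e ∩ Lᶜ)) - prob p U * prob p (e ∩ Lᶜ)) := by
  intro e L γ U
  have hU : IsUpperSet U := isUpperSet_clusterInEvent ends a₁ h𝓔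
  have hγ : IsUpperSet γ := isUpperSet_connEvent ends a₃ o
  have hLγ : IsUpperSet (L ∪ γ) := isUpperSet_L_union_γ ends a₁ a₃ o
  -- Harris for `(U, γ)` and `(U, L ∪ γ)`
  have t1 : 0 ≤ prob p (U ∩ γ) - prob p U * prob p γ := by
    have := prob_mul_prob_le_prob_inter hp hU hγ
    linarith
  have t2 : 0 ≤ prob p (U ∩ (L ∪ γ)) - prob p U * prob p (L ∪ γ) := by
    have := prob_mul_prob_le_prob_inter hp hU hLγ
    linarith
  -- the cross-cluster slack with the root avoiding `{a₃, o}`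
  have t3 : 0 ≤ prob p (U ∩ (eᶜ ∩ Lᶜ)) * prob p (eᶜ ∩ Lᶜ ∩ γ) -
      prob p (U ∩ γ ∩ (eᶜ ∩ Lᶜ)) * prob p (eᶜ ∩ Lᶜ) := by
    have := bhk_cross_cluster_avoid p hp ends a₁ a₃ (X := {a₃, o})
      (by simp) h𝓔 (ZCPendant.isUpperSet_mem_o (V := V) o)
    rw [ZCPendant.clusterInEvent_mem_o_eq, avoidAll_pair_eq] at this
    have s2 : γ ∩ (eᶜ ∩ Lᶜ) = eᶜ ∩ Lᶜ ∩ γ := Set.inter_comm _ _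
    rw [s2] at this
    linarith
  have hD : 0 ≤ prob p (eᶜ ∩ Lᶜ ∩ γᶜ) := prob_nonneg hp _
  have hB : 0 ≤ prob p (eᶜ ∩ Lᶜ ∩ γ) := prob_nonneg hp _
  rw [zc_main_identity p ends a₁ a₃ o 𝓔]
  have m1 := mul_nonneg hD t1
  have m2 := mul_nonneg hB t2
  linarith

end Main

end ZCMain

end Summit.Ventures.PercRepro2
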